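import Summits.RiemannHypothesis.RiemannHypothesis.Theorems.WeilTwoPrimeCellsT224
import Summits.RiemannHypothesis.RiemannHypothesis.Theorems.GroundBartaEvenWinsBeyondArchTwoPrimeMomentLevelShift
import HarnessLib

/-!
# Two-prime minorant cells on `[0, 224]`: the moment check from ten chunk facts, at any level

Bookkeeping for the certificates on the extended chain `weilTwoPrimeCellsT224 = weilTwoPrimeCellsT120 ++ (X224C0 ++ ⋯ ++ X224C3)`
(prover A g11): the chain moment splits over the TEN kernel-sized chunks (`tl_cellsMomentQ₂₃_T224_split`), its power integral is
`224^{q+1}/(q+1)` (`tl_cellsPowInt_T224`), and one entry `checkNuAt q` of the moment check of a `WeilCert23` whose cells are the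
`[0, 224]` chain and whose level is ANY `wL'` follows from ten kernel facts `cellsMomentQ₂₃ wL₁₂₀ chunkᵢ q = vᵢ` stated at the
LANDED level `wL₁₂₀ = weilTwoPrimeCellsT120Level` (so the 816 facts already in the tree for the six `[0, 120]` chunks, `q ≤ 542`,
are reused verbatim) plus the literal shift `(wL' − wL₁₂₀) · 224^{q+1}/(q+1)` (**`tl_checkNuAt_of_partsT224_level`**).
Pure bookkeeping over `ℚ`; everything is proved.
-/

set_option linter.dupNamespace false

noncomputable section

namespace Summit.RiemannHypothesis.RiemannHypothesis.Theorems.EvenWinsBeyondArch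

open Literature.NumberTheory.LFunctions

/-- The cell sum on `[0, 224]` split over the ten kernel-sized chunks (six of `[0, 120]`, four of `[120, 224]`). [folklore] -/
theorem tl_cellsMomentQ₂₃_T224_split (wL : ℚ) (q : ℕ) :
    cellsMomentQ₂₃ wL weilTwoPrimeCellsT224 q =
      cellsMomentQ₂₃ wL weilTwoPrimeCellsT120C0 q + cellsMomentQ₂₃ wL weilTwoPrimeCellsT120C1 q +
        cellsMomentQ₂₃ wL weilTwoPrimeCellsT120C2 q + cellsMomentQ₂₃ wL weilTwoPrimeCellsT120C3 q +
        cellsMomentQ₂₃ wL weilTwoPrimeCellsT120C4 q + cellsMomentQ₂₃ wL weilTwoPrimeCellsT120C5 q +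
        cellsMomentQ₂₃ wL weilTwoPrimeCellsX224C0 q + cellsMomentQ₂₃ wL weilTwoPrimeCellsX224C1 q +
        cellsMomentQ₂₃ wL weilTwoPrimeCellsX224C2 q + cellsMomentQ₂₃ wL weilTwoPrimeCellsX224C3 q := by
  simp only [weilTwoPrimeCellsT224, weilTwoPrimeCellsT120, cellsMomentQ₂₃_append, add_assoc]

/-- The power integrals of the chain on `[0, 224]`: `224^{q+1}/(q+1)`. [folklore] -/
theorem tl_cellsPowInt_T224 (q : ℕ) :
    tl_cellsPowInt weilTwoPrimeCellsT224 q = (224 : ℚ) ^ (q + 1) / ((q : ℚ) + 1) := by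
  rw [tl_cellsPowInt_of_chain q weilTwoPrimeCellsT224 0 224 checkChain_weilTwoPrimeCellsT224,
    zero_pow (Nat.succ_ne_zero q), sub_zero]

/-- **One entry of the moment check on the `[0, 224]` chain at any level, from the ten chunk facts at the landed level.**
For a certificate `c` whose cells are `weilTwoPrimeCellsT224` and whose level is `wL'`: if the ten chunk sums AT THE LEVEL
`wL₁₂₀ = weilTwoPrimeCellsT120Level` have the values `v₀, …, v₉` and the claimed entry passes
`|ν̃_q − nuScale · a₀^q · 2 (v₀ + ⋯ + v₉ + (wL' − wL₁₂₀) · 224^{q+1}/(q+1))| ≤ 2^{-pnu}`, then `c.checkNuAt q`. [folklore] -/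
theorem tl_checkNuAt_of_partsT224_level (c : WeilCert23) (hcells : c.cells = weilTwoPrimeCellsT224)
    {wL' : ℚ} (hwL : c.base.wL = wL') (q : ℕ) {v₀ v₁ v₂ v₃ v₄ v₅ v₆ v₇ v₈ v₉ : ℚ}
    (h₀ : cellsMomentQ₂₃ weilTwoPrimeCellsT120Level weilTwoPrimeCellsT120C0 q = v₀)
    (h₁ : cellsMomentQ₂₃ weilTwoPrimeCellsT120Level weilTwoPrimeCellsT120C1 q = v₁)
    (h₂ : cellsMomentQ₂₃ weilTwoPrimeCellsT120Level weilTwoPrimeCellsT120C2 q = v₂)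
    (h₃ : cellsMomentQ₂₃ weilTwoPrimeCellsT120Level weilTwoPrimeCellsT120C3 q = v₃)
    (h₄ : cellsMomentQ₂₃ weilTwoPrimeCellsT120Level weilTwoPrimeCellsT120C4 q = v₄)
    (h₅ : cellsMomentQ₂₃ weilTwoPrimeCellsT120Level weilTwoPrimeCellsT120C5 q = v₅)
    (h₆ : cellsMomentQ₂₃ weilTwoPrimeCellsT120Level weilTwoPrimeCellsX224C0 q = v₆)
    (h₇ : cellsMomentQ₂₃ weilTwoPrimeCellsT120Level weilTwoPrimeCellsX224C1 q = v₇)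
    (h₈ : cellsMomentQ₂₃ weilTwoPrimeCellsT120Level weilTwoPrimeCellsX224C2 q = v₈)
    (h₉ : cellsMomentQ₂₃ weilTwoPrimeCellsT120Level weilTwoPrimeCellsX224C3 q = v₉)
    (hlit : |getV c.nuData q - nuScale * (c.base.a0 ^ q *
      (2 * (v₀ + v₁ + v₂ + v₃ + v₄ + v₅ + v₆ + v₇ + v₈ + v₉ +
        (wL' - weilTwoPrimeCellsT120Level) * ((224 : ℚ) ^ (q + 1) / ((q : ℚ) + 1)))))| ≤
      1 / 2 ^ c.pnu) :
    c.checkNuAt q = true := by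
  unfold WeilCert23.checkNuAt WeilCert23.nuQ
  rw [decide_eq_true_eq, hcells, hwL,
    tl_cellsMomentQ₂₃_level weilTwoPrimeCellsT224 weilTwoPrimeCellsT120Level wL' q,
    tl_cellsMomentQ₂₃_T224_split, h₀, h₁, h₂, h₃, h₄, h₅, h₆, h₇, h₈, h₉, tl_cellsPowInt_T224]
  exact hlit

/-- The same with the total sum named: if `Σᵢ vᵢ = V` at the level `wL₁₂₀` then the shifted entry is
`V + (wL' − wL₁₂₀) · 224^{q+1}/(q+1)`. [folklore] -/
theorem tl_checkNuAt_of_sumT224_level (c : WeilCert23) (hcells : c.cells = weilTwoPrimeCellsT224)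
    {wL' : ℚ} (hwL : c.base.wL = wL') (q : ℕ) {V : ℚ}
    (hV : cellsMomentQ₂₃ weilTwoPrimeCellsT120Level weilTwoPrimeCellsT224 q = V)
    (hlit : |getV c.nuData q - nuScale * (c.base.a0 ^ q *
      (2 * (V + (wL' - weilTwoPrimeCellsT120Level) * ((224 : ℚ) ^ (q + 1) / ((q : ℚ) + 1)))))| ≤
      1 / 2 ^ c.pnu) :
    c.checkNuAt q = true := by
  unfold WeilCert23.checkNuAt WeilCert23.nuQ
  rw [decide_eq_true_eq, hcells, hwL,
    tl_cellsMomentQ₂₃_level weilTwoPrimeCellsT224 weilTwoPrimeCellsT120Level wL' q, hV, tl_cellsPowInt_T224]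
  exact hlit

end Summit.RiemannHypothesis.RiemannHypothesis.Theorems.EvenWinsBeyondArch
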